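import Literature.Geometry.Riemannian.PinchingEstimatesImproving
import Literature.Geometry.Riemannian.PinchingEstimatesImprovingQScalar
import Literature.Geometry.Riemannian.PinchingEstimatesImprovingQSpectral
import HarnessLib

/-!
# Hamilton 1997, Thm. 2.3 (improving pinching, second form) at the level of the curvature ODE
(topic `Geometry/Riemannian`)

Part of the decomposition of `Literature.Geometry.Riemannian.hamilton_chenZhu_pinching`
(`PinchingEstimates.lean`). Hamilton 1997, §2.2, Thm. 2.3 (p. 17): "We can find constants `L`,
`P`, and `Q` depending on `Λ`, `Ω`, `ρ` and `K` given as before, such that the inequality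
`b₃/√((a₁+ρ)(c₁+ρ)) ≤ 1 + L e^{Pt}/max{ln √((a₁+ρ)(c₁+ρ)), Q}` is true at `t = 0` and is
preserved by the Ricci flow." PROVED here at the ODE level (the invariance part), in exactly
the shape of the hypothesis `h23` of `hamilton_chenZhu_pinching_of_ode₁`
(`PinchingEstimatesReduction5.lean`), with `Q = 2` (which is Chen–Zhu's (2.3)):

* `hamilton1997_B23_ode` — for `0 < m, Λ, Ξ, ρ, Ω` and any `K` there are `Q = 2`,
  `L₀ = impQL₀ m ρ Ω K`, `P₀ = 0` such that for `L ≥ L₀`, `P ≥ P₀`, `L, P > 0` the family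
  `{ImprovedPinchingQ p ρ L P Q t}` is forward invariant under Hamilton's ODE relative to the
  previous estimates (symmetry, `a₁+a₂, c₁+c₂ ≥ m`, `PinchedBy ρ Ω`, Thm. 2.1's
  `ImprovedPinching K` and Thm. 1.9's `b₃ ≤ (L/2)e^{Pt}√((a₁+ρ)(c₁+ρ))`).

Proof (Hamilton, pp. 17–20): below the corner `u = e²` the inequality reads
`b₃ ≤ (1 + Le^{Pt}/2)u`, implied by Thm. 1.9's bound; on the `C¹` branch
`G = impFn (Le^{Pt}) 2 (u) - uᵀBv` the minimum principle `minOverSet_nonneg_of_deriv` applies;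
at a minimiser with `G ≤ 0`, `u ≥ e²`, Hamilton's first case is excluded (`caseA_absurd`) and
in the second case the exact derivative is controlled by `rayleighMin_package`,
`singular_upper` and `lemma23`.

## References

* R. S. Hamilton, *Four-manifolds with positive isotropic curvature*, Comm. Anal. Geom. 5 (1997)
  1–92, §2.2, Thm. 2.3 (pp. 17–20). [Hamilton1997]
* B.-L. Chen, X.-P. Zhu, J. Differential Geom. 74 (2006), §2, Lemma 2.1, (2.3). [ChenZhu2006]
-/

noncomputable section

open Set Real Filter
open scoped Matrix BigOperators Topology

namespace Literature.Geometry.Riemannian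

namespace HamiltonODE

/-! ### The functional -/

/-- `U(q) = (wᵀAw + ρ)(zᵀCz + ρ)` for `q = ((u, v), (w, z))`. [folklore] -/
def impQX (ρ : ℝ) (p : Blocks) (q : QQ) : ℝ :=
  (q.2.1 ⬝ᵥ (p.1 *ᵥ q.2.1) + ρ) * (q.2.2 ⬝ᵥ (p.2.2 *ᵥ q.2.2) + ρ)

/-- Hamilton's Thm. 2.3 functional on the `C¹` branch: `G = impFn (Le^{Pt}) 2 (√U) - uᵀBv`.
[cite: Hamilton1997, §2.2, Thm. 2.3 (p. 17)] -/
def impQG (ρ L P t : ℝ) (p : Blocks) (q : QQ) : ℝ :=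
  impFn (L * exp (P * t)) 2 (sqrt (impQX ρ p q)) - q.1.1 ⬝ᵥ (p.2.1 *ᵥ q.1.2)

/-- Its time derivative along a curve of blocks with velocity `p'`. [folklore] -/
def impQG' (ρ L P t : ℝ) (p p' : Blocks) (q : QQ) : ℝ :=
  impFnDeriv (L * exp (P * t)) 2 (sqrt (impQX ρ p q)) *
      (((q.2.1 ⬝ᵥ (p'.1 *ᵥ q.2.1)) * (q.2.2 ⬝ᵥ (p.2.2 *ᵥ q.2.2) + ρ) +
        (q.2.1 ⬝ᵥ (p.1 *ᵥ q.2.1) + ρ) * (q.2.2 ⬝ᵥ (p'.2.2 *ᵥ q.2.2))) /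
          (2 * sqrt (impQX ρ p q))) +
    L * P * exp (P * t) * phiQ 2 (sqrt (impQX ρ p q)) - q.1.1 ⬝ᵥ (p'.2.1 *ᵥ q.1.2)

/-- The constant `L₀(m, ρ, Ω, K)` of Thm. 2.3 (explicit; `K⁺ = max{K, 0}`). [folklore] -/
def impQL₀ (m ρ Ω K : ℝ) : ℝ :=
  max K 0 * ((1 + ρ / m) + 2) + 1 +
    (2 + max K 0) * ((1 + 2 * ρ / m) * (Ω * (1 + 2 * ρ / m) + 2 * ρ / m + 1)) * (8 * Ω * ρ) +
    (2 + max K 0) * ((1 + 2 * ρ / m) * (Ω * (1 + 2 * ρ / m) + 2 * ρ / m + 1)) *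
      (4 * Ω * (4 * Ω * (Ω + 2 * Ω * ρ / m + 2)))

variable {ρ L P : ℝ} {p : Blocks}

/-- `ImprovedPinchingQ … 2 t` implies `G ≥ 0` on the parameter set, when `U > 0` there. [folklore] -/
theorem impQG_nonneg_of_improvedPinchingQ {t : ℝ} (hL : 0 ≤ L) (hpos : ∀ q ∈ unitSet4, 0 < impQX ρ p q)
    (h : ImprovedPinchingQ p ρ L P 2 t) {q : QQ} (hq : q ∈ unitSet4) : 0 ≤ impQG ρ L P t p q := by
  obtain ⟨⟨u, v⟩, ⟨w, z⟩⟩ := q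
  obtain ⟨⟨hu, hv⟩, ⟨hw, hz⟩⟩ := hq
  have hX := hpos _ ⟨⟨hu, hv⟩, ⟨hw, hz⟩⟩
  have h1 := h u v w z hu hv hw hz
  have hK : 0 ≤ L * exp (P * t) := mul_nonneg hL (exp_pos _).le
  have h2 := hamiltonFn_le_impFn (Q := 2) (K := L * exp (P * t)) (by norm_num) hK (Real.sqrt_pos.2 hX)
  simp only [impQG, impQX] at h2 hX ⊢
  linarith

/-- Conversely, `G ≥ 0` and the linear bound `uᵀBv ≤ (1 + Le^{Pt}/2)√U` give
`ImprovedPinchingQ … 2 t`. [cite: Hamilton1997, §2.2, Thm. 2.3 (proof, p. 17)] -/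
theorem improvedPinchingQ_of_impQG_nonneg {t : ℝ} (hpos : ∀ q ∈ unitSet4, 0 < impQX ρ p q)
    (hlin : ∀ q ∈ unitSet4, q.1.1 ⬝ᵥ (p.2.1 *ᵥ q.1.2) ≤ (1 + L * exp (P * t) / 2) * sqrt (impQX ρ p q))
    (h : ∀ q ∈ unitSet4, 0 ≤ impQG ρ L P t p q) : ImprovedPinchingQ p ρ L P 2 t := by
  intro u v w z hu hv hw hz
  have hq : (((u, v), (w, z)) : QQ) ∈ unitSet4 := ⟨⟨hu, hv⟩, ⟨hw, hz⟩⟩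
  have hX := hpos _ hq
  have hG := h _ hq
  have hl := hlin _ hq
  simp only [impQG, impQX] at hG hX hl ⊢
  set x := sqrt ((w ⬝ᵥ (p.1 *ᵥ w) + ρ) * (z ⬝ᵥ (p.2.2 *ᵥ z) + ρ)) with hx
  have hx0 : 0 < x := Real.sqrt_pos.2 hX
  rcases le_or_gt (exp 2) x with hex | hlt
  · rw [← impFn_eq_hamiltonFn hex]; linarith
  · rw [hamiltonFn_of_lt hx0 hlt]; exact hl

/-! ### Calculus -/

/-- Derivative of `G` along a differentiable curve of blocks (where `U > 0`). [folklore] -/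
theorem hasDerivAt_impQG (ρ L P : ℝ) {γ : ℝ → Blocks} {γ' : Blocks} {s : ℝ} (hγ : HasDerivAt γ γ' s)
    (q : QQ) (hpos : 0 < impQX ρ (γ s) q) :
    _root_.HasDerivAt (fun t ↦ impQG ρ L P t (γ t) q) (impQG' ρ L P s (γ s) γ' q) s := by
  have hXA : _root_.HasDerivAt (fun t ↦ q.2.1 ⬝ᵥ ((γ t).1 *ᵥ q.2.1) + ρ)
      (q.2.1 ⬝ᵥ (γ'.1 *ᵥ q.2.1)) s := (hasDerivAt_quadForm hγ.1 _ _).add_const ρ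
  have hXC : _root_.HasDerivAt (fun t ↦ q.2.2 ⬝ᵥ ((γ t).2.2 *ᵥ q.2.2) + ρ)
      (q.2.2 ⬝ᵥ (γ'.2.2 *ᵥ q.2.2)) s := (hasDerivAt_quadForm hγ.2.2 _ _).add_const ρ
  have hX : _root_.HasDerivAt (fun t ↦ impQX ρ (γ t) q)
      ((q.2.1 ⬝ᵥ (γ'.1 *ᵥ q.2.1)) * (q.2.2 ⬝ᵥ ((γ s).2.2 *ᵥ q.2.2) + ρ) +
        (q.2.1 ⬝ᵥ ((γ s).1 *ᵥ q.2.1) + ρ) * (q.2.2 ⬝ᵥ (γ'.2.2 *ᵥ q.2.2))) s := by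
    have h := hXA.mul hXC
    show _root_.HasDerivAt ((fun t ↦ q.2.1 ⬝ᵥ ((γ t).1 *ᵥ q.2.1) + ρ) *
      fun t ↦ q.2.2 ⬝ᵥ ((γ t).2.2 *ᵥ q.2.2) + ρ) _ s
    exact h
  have hsx := hX.sqrt hpos.ne'
  have hx0 : 0 < sqrt (impQX ρ (γ s) q) := Real.sqrt_pos.2 hpos
  have hE : _root_.HasDerivAt (fun t ↦ L * exp (P * t)) (L * P * exp (P * s)) s := by
    have h := ((hasDerivAt_id s).const_mul P).exp.const_mul L
    refine h.congr_deriv ?_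
    simp only [id, mul_one]; ring
  have hφ := (hasDerivAt_phiQ (Q := 2) (by norm_num) hx0).comp s hsx
  have hY : _root_.HasDerivAt (fun t ↦ q.1.1 ⬝ᵥ ((γ t).2.1 *ᵥ q.1.2)) (q.1.1 ⬝ᵥ (γ'.2.1 *ᵥ q.1.2)) s :=
    hasDerivAt_quadForm hγ.2.1 _ _
  have h := (hsx.add (hE.mul hφ)).sub hY
  have e : (fun t ↦ impQG ρ L P t (γ t) q) = fun t ↦
      sqrt (impQX ρ (γ t) q) + L * exp (P * t) * (phiQ 2 ∘ fun t ↦ sqrt (impQX ρ (γ t) q)) t -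
        q.1.1 ⬝ᵥ ((γ t).2.1 *ᵥ q.1.2) := by
    funext t; simp only [impQG, impFn, Function.comp]
  rw [e]
  refine h.congr_deriv ?_
  simp only [impQG', impFnDeriv, Function.comp]
  ring

/-- `(p, q) ↦ U` is continuous. [folklore] -/
theorem continuous_impQX (ρ : ℝ) : Continuous fun z : Blocks × QQ ↦ impQX ρ z.1 z.2 := by
  unfold impQX
  have hq := continuous_quadForm
  have hA : Continuous fun z : Blocks × QQ ↦ z.1.1 := continuous_fst.comp continuous_fst
  have hC : Continuous fun z : Blocks × QQ ↦ z.1.2.2 := continuous_snd.comp (continuous_snd.comp continuous_fst)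
  have hw : Continuous fun z : Blocks × QQ ↦ z.2.2.1 := continuous_fst.comp (continuous_snd.comp continuous_snd)
  have hz : Continuous fun z : Blocks × QQ ↦ z.2.2.2 := continuous_snd.comp (continuous_snd.comp continuous_snd)
  exact ((hq.comp (hA.prodMk (hw.prodMk hw))).add continuous_const).mul
    ((hq.comp (hC.prodMk (hz.prodMk hz))).add continuous_const)

/-- `(t, p, q) ↦ G` is continuous where `U > 0`. [folklore] -/
theorem continuousOn_impQG (ρ L P : ℝ) :
    ContinuousOn (fun z : ℝ × Blocks × QQ ↦ impQG ρ L P z.1 z.2.1 z.2.2) {z | 0 < impQX ρ z.2.1 z.2.2} := by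
  unfold impQG impFn
  have hX : Continuous fun z : ℝ × Blocks × QQ ↦ impQX ρ z.2.1 z.2.2 :=
    (continuous_impQX ρ).comp continuous_snd
  have hsx : Continuous fun z : ℝ × Blocks × QQ ↦ sqrt (impQX ρ z.2.1 z.2.2) := continuous_sqrt.comp hX
  have hφ : ContinuousOn (fun z : ℝ × Blocks × QQ ↦ phiQ 2 (sqrt (impQX ρ z.2.1 z.2.2)))
      {z | 0 < impQX ρ z.2.1 z.2.2} :=
    (continuousOn_phiQ (Q := 2) (by norm_num)).comp hsx.continuousOn fun z hz ↦ Real.sqrt_pos.2 hz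
  have hE : Continuous fun z : ℝ × Blocks × QQ ↦ L * exp (P * z.1) :=
    continuous_const.mul (continuous_exp.comp (continuous_const.mul continuous_fst))
  have hY : Continuous fun z : ℝ × Blocks × QQ ↦ z.2.2.1.1 ⬝ᵥ (z.2.1.2.1 *ᵥ z.2.2.1.2) :=
    continuous_quadForm.comp ((continuous_fst.comp (continuous_snd.comp (continuous_fst.comp continuous_snd))).prodMk
      ((continuous_fst.comp (continuous_fst.comp (continuous_snd.comp continuous_snd))).prodMk
        (continuous_snd.comp (continuous_fst.comp (continuous_snd.comp continuous_snd)))))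
  exact (hsx.continuousOn.add (hE.continuousOn.mul hφ)).sub hY.continuousOn

/-- `(t, p, p', q) ↦ G'` is continuous where `U > 0`. [folklore] -/
theorem continuousOn_impQG' (ρ L P : ℝ) :
    ContinuousOn (fun z : ℝ × Blocks × Blocks × QQ ↦ impQG' ρ L P z.1 z.2.1 z.2.2.1 z.2.2.2)
      {z | 0 < impQX ρ z.2.1 z.2.2.2} := by
  unfold impQG' impFnDeriv
  have hq := continuous_quadForm
  have ht : Continuous fun z : ℝ × Blocks × Blocks × QQ ↦ z.1 := continuous_fst
  have hp : Continuous fun z : ℝ × Blocks × Blocks × QQ ↦ z.2.1 := continuous_fst.comp continuous_snd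
  have hp' : Continuous fun z : ℝ × Blocks × Blocks × QQ ↦ z.2.2.1 :=
    continuous_fst.comp (continuous_snd.comp continuous_snd)
  have hQ : Continuous fun z : ℝ × Blocks × Blocks × QQ ↦ z.2.2.2 :=
    continuous_snd.comp (continuous_snd.comp continuous_snd)
  have hX : Continuous fun z : ℝ × Blocks × Blocks × QQ ↦ impQX ρ z.2.1 z.2.2.2 :=
    (continuous_impQX ρ).comp (hp.prodMk hQ)
  have hsx : Continuous fun z : ℝ × Blocks × Blocks × QQ ↦ sqrt (impQX ρ z.2.1 z.2.2.2) :=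
    continuous_sqrt.comp hX
  have hmaps : MapsTo (fun z : ℝ × Blocks × Blocks × QQ ↦ sqrt (impQX ρ z.2.1 z.2.2.2))
      {z | 0 < impQX ρ z.2.1 z.2.2.2} (Ioi 0) := fun z hz ↦ Real.sqrt_pos.2 hz
  have hφ' : ContinuousOn (fun z : ℝ × Blocks × Blocks × QQ ↦ phiQDeriv 2 (sqrt (impQX ρ z.2.1 z.2.2.2)))
      {z | 0 < impQX ρ z.2.1 z.2.2.2} :=
    (continuousOn_phiQDeriv (Q := 2) (by norm_num)).comp hsx.continuousOn hmaps
  have hφ : ContinuousOn (fun z : ℝ × Blocks × Blocks × QQ ↦ phiQ 2 (sqrt (impQX ρ z.2.1 z.2.2.2)))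
      {z | 0 < impQX ρ z.2.1 z.2.2.2} :=
    (continuousOn_phiQ (Q := 2) (by norm_num)).comp hsx.continuousOn hmaps
  have hE : Continuous fun z : ℝ × Blocks × Blocks × QQ ↦ L * exp (P * z.1) :=
    continuous_const.mul (continuous_exp.comp (continuous_const.mul ht))
  have hE' : Continuous fun z : ℝ × Blocks × Blocks × QQ ↦ L * P * exp (P * z.1) :=
    continuous_const.mul (continuous_exp.comp (continuous_const.mul ht))
  have hA := continuous_fst.comp hp
  have hC := continuous_snd.comp (continuous_snd.comp hp)
  have hA' := continuous_fst.comp hp'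
  have hB' := continuous_fst.comp (continuous_snd.comp hp')
  have hC' := continuous_snd.comp (continuous_snd.comp hp')
  have hu := continuous_fst.comp (continuous_fst.comp hQ)
  have hv := continuous_snd.comp (continuous_fst.comp hQ)
  have hw := continuous_fst.comp (continuous_snd.comp hQ)
  have hz := continuous_snd.comp (continuous_snd.comp hQ)
  have hnum : Continuous fun z : ℝ × Blocks × Blocks × QQ ↦
      (z.2.2.2.2.1 ⬝ᵥ (z.2.2.1.1 *ᵥ z.2.2.2.2.1)) * (z.2.2.2.2.2 ⬝ᵥ (z.2.1.2.2 *ᵥ z.2.2.2.2.2) + ρ) +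
        (z.2.2.2.2.1 ⬝ᵥ (z.2.1.1 *ᵥ z.2.2.2.2.1) + ρ) * (z.2.2.2.2.2 ⬝ᵥ (z.2.2.1.2.2 *ᵥ z.2.2.2.2.2)) :=
    ((hq.comp (hA'.prodMk (hw.prodMk hw))).mul ((hq.comp (hC.prodMk (hz.prodMk hz))).add continuous_const)).add
      (((hq.comp (hA.prodMk (hw.prodMk hw))).add continuous_const).mul (hq.comp (hC'.prodMk (hz.prodMk hz))))
  have hquot : ContinuousOn (fun z : ℝ × Blocks × Blocks × QQ ↦
      ((z.2.2.2.2.1 ⬝ᵥ (z.2.2.1.1 *ᵥ z.2.2.2.2.1)) * (z.2.2.2.2.2 ⬝ᵥ (z.2.1.2.2 *ᵥ z.2.2.2.2.2) + ρ) +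
        (z.2.2.2.2.1 ⬝ᵥ (z.2.1.1 *ᵥ z.2.2.2.2.1) + ρ) * (z.2.2.2.2.2 ⬝ᵥ (z.2.2.1.2.2 *ᵥ z.2.2.2.2.2))) /
        (2 * sqrt (impQX ρ z.2.1 z.2.2.2))) {z | 0 < impQX ρ z.2.1 z.2.2.2} :=
    hnum.continuousOn.div (continuous_const.mul hsx).continuousOn
      fun z hz ↦ mul_ne_zero two_ne_zero (Real.sqrt_pos.2 hz).ne'
  have hY' : Continuous fun z : ℝ × Blocks × Blocks × QQ ↦ z.2.2.2.1.1 ⬝ᵥ (z.2.2.1.2.1 *ᵥ z.2.2.2.1.2) :=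
    hq.comp (hB'.prodMk (hu.prodMk hv))
  exact (((continuousOn_const.add (hE.continuousOn.mul hφ')).mul hquot).add
    (hE'.continuousOn.mul hφ)).sub hY'.continuousOn

attribute [local irreducible] impQG in
/-- Joint continuity of `G` along a continuous curve of blocks with `U > 0`. [folklore] -/
theorem continuousOn_impQG_family (ρ L P : ℝ) {γ : ℝ → Blocks} {S : Set ℝ} (hγ : ContinuousOn γ S)
    (hpos : ∀ s ∈ S, ∀ q ∈ unitSet4, 0 < impQX ρ (γ s) q) :
    ContinuousOn (fun z : ℝ × QQ ↦ impQG ρ L P z.1 (γ z.1) z.2) (S ×ˢ unitSet4) := by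
  have h1 : ContinuousOn (fun z : ℝ × QQ ↦ γ z.1) (S ×ˢ unitSet4) :=
    hγ.comp continuousOn_fst fun z hz ↦ (Set.mem_prod.1 hz).1
  refine (continuousOn_impQG ρ L P).comp (continuousOn_fst.prodMk (h1.prodMk continuousOn_snd))
    fun z hz ↦ ?_
  obtain ⟨hs, hq⟩ := Set.mem_prod.1 hz
  exact hpos z.1 hs z.2 hq

attribute [local irreducible] impQG' in
/-- Joint continuity of `G'` along a continuous solution with `U > 0`. [folklore] -/
theorem continuousOn_impQG'_family (ρ L P : ℝ) {γ : ℝ → Blocks} {S : Set ℝ} (hγ : ContinuousOn γ S)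
    (hpos : ∀ s ∈ S, ∀ q ∈ unitSet4, 0 < impQX ρ (γ s) q) :
    ContinuousOn (fun z : ℝ × QQ ↦ impQG' ρ L P z.1 (γ z.1) (field (γ z.1)) z.2) (S ×ˢ unitSet4) := by
  have h1 : ContinuousOn (fun z : ℝ × QQ ↦ γ z.1) (S ×ˢ unitSet4) :=
    hγ.comp continuousOn_fst fun z hz ↦ (Set.mem_prod.1 hz).1
  refine (continuousOn_impQG' ρ L P).comp (continuousOn_fst.prodMk
    (h1.prodMk ((continuous_field.comp_continuousOn h1).prodMk continuousOn_snd))) fun z hz ↦ ?_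
  obtain ⟨hs, hq⟩ := Set.mem_prod.1 hz
  exact hpos z.1 hs z.2 hq

/-! ### The sign condition at a minimiser -/

/-- **Barrier form of Hamilton's boundary computation for Thm. 2.3** (p. 19–20): from
`κ² ℓ ≤ K_t(1+κ)(ℓ - D)` (`lemma23`), `G = (1+κ)u - Y ≤ 0`, `Y' ≤ Y D`, `D ≤ M` and the exact
derivative `G' = (1 + κ - κ/ln u) u ℓ + P κ u - Y'`, conclude `M G ≤ G'`.
[cite: Hamilton1997, §2.2, Thm. 2.3 (proof, pp. 19–20)] -/
theorem bookkeeping23 {ℓ D κ Ks ℓn υ P' Y G G' M YB' : ℝ}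
    (hkey : κ ^ 2 * ℓ ≤ Ks * (1 + κ) * (ℓ - D)) (hκ : κ = Ks / ℓn) (hℓn : 0 < ℓn) (hKs : 0 < Ks)
    (hυ : 0 < υ) (hP : 0 ≤ P') (hG : G = (1 + κ) * υ - Y) (hG0 : G ≤ 0) (hYB : YB' ≤ Y * D)
    (hDM : D ≤ M) (hG' : G' = (1 + κ - κ / ℓn) * υ * ℓ + P' * κ * υ - YB') : M * G ≤ G' := by
  have hκ0 : 0 < κ := by rw [hκ]; exact div_pos hKs hℓn
  have e : κ / ℓn = κ ^ 2 / Ks := by rw [hκ]; field_simp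
  have h1 : κ / ℓn * ℓ ≤ (1 + κ) * (ℓ - D) := by
    rw [e, div_mul_eq_mul_div, div_le_iff₀ hKs]; linarith only [hkey]
  have h2 : 0 ≤ υ * ((1 + κ) * (ℓ - D) - κ / ℓn * ℓ + P' * κ) := by
    have := mul_nonneg hP hκ0.le
    exact mul_nonneg hυ.le (by linarith only [h1, this])
  have h3 : M * G ≤ D * G := mul_le_mul_of_nonpos_right hDM hG0
  have h4 : G' = υ * ((1 + κ) * (ℓ - D) - κ / ℓn * ℓ + P' * κ) + D * G + (Y * D - YB') := by
    rw [hG', hG]; ring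
  rw [h4]; linarith only [h2, h3, hYB]

/-- Unpacking `L ≥ impQL₀ m ρ Ω K`: the three lower bounds used. [folklore] -/
theorem impQL₀_le {m Ω K : ℝ} (hm : 0 < m) (hρ : 0 < ρ) (hΩ : 0 < Ω) (hL : impQL₀ m ρ Ω K ≤ L) :
    max K 0 * ((1 + ρ / m) + 2) < L ∧
      (2 + max K 0) * ((1 + 2 * ρ / m) * (Ω * (1 + 2 * ρ / m) + 2 * ρ / m + 1)) * (8 * Ω * ρ) ≤ L ∧
      (2 + max K 0) * ((1 + 2 * ρ / m) * (Ω * (1 + 2 * ρ / m) + 2 * ρ / m + 1)) *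
        (4 * Ω * (4 * Ω * (Ω + 2 * Ω * ρ / m + 2))) ≤ L := by
  have hKp : 0 ≤ max K 0 := le_max_right _ _
  have h1 : 0 ≤ max K 0 * ((1 + ρ / m) + 2) := by positivity
  have h2 : 0 ≤ (2 + max K 0) * ((1 + 2 * ρ / m) * (Ω * (1 + 2 * ρ / m) + 2 * ρ / m + 1)) *
      (8 * Ω * ρ) := by positivity
  have h3 : 0 ≤ (2 + max K 0) * ((1 + 2 * ρ / m) * (Ω * (1 + 2 * ρ / m) + 2 * ρ / m + 1)) *
      (4 * Ω * (4 * Ω * (Ω + 2 * Ω * ρ / m + 2))) := by positivity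
  simp only [impQL₀] at hL
  exact ⟨by linarith only [hL, h2, h3], by linarith only [hL, h1, h3], by linarith only [hL, h1, h2]⟩

/-- **The sign condition at a minimiser of `G`** (pointwise form of Hamilton's Thm. 2.3): with the
constraint data at a time `s ≥ 0`, `L ≥ L₀`, `P ≥ 0`, and `R ≥ Σ|A| + Σ|B| + Σ|C|`, if `G ≤ 0` at
a minimiser then `4R · G ≤ G'`. [cite: Hamilton1997, §2.2, Thm. 2.3 (proof, pp. 17–20)] -/
theorem improvingQ_sign {m Ω K R s : ℝ} (hm : 0 < m) (hρ : 0 < ρ) (hΩ : 0 < Ω)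
    (hL : impQL₀ m ρ Ω K ≤ L) (hL0 : 0 < L) (hP : 0 ≤ P) (hs : 0 ≤ s) {p : Blocks}
    (hA : p.1.IsSymm) (hC : p.2.2.IsSymm) (h12A : p.1.TwoSmallestEigenvaluesSumGE m)
    (h12C : p.2.2.TwoSmallestEigenvaluesSumGE m) (hPB : Matrix.PinchedBy p.1 p.2.1 p.2.2 ρ Ω)
    (hIP : ImprovedPinching p K) (hSV : SingularValueLEExp p (L / 2) P ρ s)
    (hR : (∑ k, ∑ l, |p.1 k l|) + (∑ k, ∑ l, |p.2.1 k l|) + ∑ k, ∑ l, |p.2.2 k l| ≤ R)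
    {q : QQ} (hq : q ∈ unitSet4) (hqmin : IsMinOn (impQG ρ L P s p) unitSet4 q)
    (hG0 : impQG ρ L P s p q ≤ 0) :
    4 * R * impQG ρ L P s p q ≤ impQG' ρ L P s p (field p) q := by
  obtain ⟨⟨u, v⟩, ⟨w, z⟩⟩ := q
  obtain ⟨⟨hu, hv⟩, ⟨hw, hz⟩⟩ := hq
  obtain ⟨A, B, C⟩ := p
  simp only at hA hC h12A h12C hPB hIP hSV hR hqmin hG0 ⊢
  replace hu : u ⬝ᵥ u = 1 := hu
  replace hv : v ⬝ᵥ v = 1 := hv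
  replace hw : w ⬝ᵥ w = 1 := hw
  replace hz : z ⬝ᵥ z = 1 := hz
  obtain ⟨hL1, hL2, hL3⟩ := impQL₀_le hm hρ hΩ hL
  -- positivity, `υ = √U`, `K_s = L e^{Ps}`
  have hXA : 0 < w ⬝ᵥ (A *ᵥ w) + ρ := (hPB.1 w hw).1
  have hXC : 0 < z ⬝ᵥ (C *ᵥ z) + ρ := (hPB.1 z hz).2
  have hUpos : 0 < (w ⬝ᵥ (A *ᵥ w) + ρ) * (z ⬝ᵥ (C *ᵥ z) + ρ) := mul_pos hXA hXC
  set υ := sqrt ((w ⬝ᵥ (A *ᵥ w) + ρ) * (z ⬝ᵥ (C *ᵥ z) + ρ)) with hυdef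
  have hυ : 0 < υ := Real.sqrt_pos.2 hUpos
  have hυ2 : υ ^ 2 = (w ⬝ᵥ (A *ᵥ w) + ρ) * (z ⬝ᵥ (C *ᵥ z) + ρ) := Real.sq_sqrt hUpos.le
  set Ks := L * exp (P * s) with hKsdef
  have hexp : 1 ≤ exp (P * s) := Real.one_le_exp (mul_nonneg hP hs)
  have hKs : L ≤ Ks := by rw [hKsdef]; nlinarith only [hexp, hL0]
  have hKs0 : 0 < Ks := hL0.trans_le hKs
  set Y := u ⬝ᵥ (B *ᵥ v) with hYdef
  have hGval : impQG ρ L P s (A, B, C) ((u, v), (w, z)) = impFn Ks 2 υ - Y := by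
    simp [impQG, impQX, hυdef, hKsdef, hYdef]
  have hG0' : impFn Ks 2 υ - Y ≤ 0 := by rw [← hGval]; exact hG0
  -- the linear bound from Thm. 1.9 and `υ ≥ e²`
  have hYlin : Y ≤ L / 2 * exp (P * s) * υ := hSV u v w z hu hv hw hz
  have hex : exp 2 ≤ υ := by
    refine exp_le_of_impFn_le (K := Ks) (by norm_num) hKs0 hυ ?_
    have : Y ≤ (1 + Ks / 2) * υ := by rw [hKsdef]; nlinarith only [hYlin, hυ]
    linarith only [this, hG0']
  have hℓn2 : 2 ≤ log υ := by
    have := Real.log_le_log (exp_pos 2) hex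
    rwa [Real.log_exp] at this
  set ℓn := log υ with hℓndef
  have hℓn0 : 0 < ℓn := by linarith only [hℓn2]
  have hℓnυ : ℓn ≤ υ := by
    have := Real.log_le_sub_one_of_pos hυ
    rw [← hℓndef] at this; linarith only [this]
  have hfx : impFn Ks 2 υ = (1 + Ks / ℓn) * υ := impFn_of_le hex
  have hfx' : impFnDeriv Ks 2 υ = 1 + Ks / ℓn - Ks / ℓn ^ 2 := impFnDeriv_of_le hex hυ
  have hφ : phiQ 2 υ = υ / ℓn := by simp only [phiQ, logBranch_of_le hex, hℓndef]
  set κ := Ks / ℓn with hκ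
  have hκ0 : 0 < κ := div_pos hKs0 hℓn0
  have hμ : (1 + κ) * υ ≤ Y := by rw [hfx] at hG0'; linarith only [hG0']
  have hYpos : 0 < Y := lt_of_lt_of_le (by positivity) hμ
  -- decoupling
  have hmaxB : ∀ u' v' : Fin 3 → ℝ, u' ⬝ᵥ u' = 1 → v' ⬝ᵥ v' = 1 → u' ⬝ᵥ (B *ᵥ v') ≤ Y := by
    intro u' v' hu' hv'
    have h := hqmin (show ((u', v'), (w, z)) ∈ unitSet4 from ⟨⟨hu', hv'⟩, ⟨hw, hz⟩⟩)
    simp only [mem_setOf_eq, impQG, impQX] at h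
    linarith only [h, hYdef]
  have hminA : ∀ w' ∈ unitSet, w ⬝ᵥ (A *ᵥ w) ≤ w' ⬝ᵥ (A *ᵥ w') := by
    intro w' hw'
    have h := hqmin (show ((u, v), (w', z)) ∈ unitSet4 from ⟨⟨hu, hv⟩, ⟨hw', hz⟩⟩)
    simp only [mem_setOf_eq, impQG, impQX] at h
    have hXA' : 0 < w' ⬝ᵥ (A *ᵥ w') + ρ := (hPB.1 w' hw').1
    have := le_of_impFn_sqrt_le (K := Ks) hKs0.le hXA hXA' hXC (by rw [hKsdef]; linarith only [h])
    linarith only [this]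
  have hminC : ∀ z' ∈ unitSet, z ⬝ᵥ (C *ᵥ z) ≤ z' ⬝ᵥ (C *ᵥ z') := by
    intro z' hz'
    have h := hqmin (show ((u, v), (w, z')) ∈ unitSet4 from ⟨⟨hu, hv⟩, ⟨hw, hz'⟩⟩)
    simp only [mem_setOf_eq, impQG, impQX] at h
    have hXC' : 0 < z' ⬝ᵥ (C *ᵥ z') + ρ := (hPB.1 z' hz').2
    have := le_of_impFn_sqrt_le (K := Ks) hKs0.le hXC hXC' hXA (by
      rw [mul_comm (z ⬝ᵥ (C *ᵥ z) + ρ), mul_comm (z' ⬝ᵥ (C *ᵥ z') + ρ), hKsdef]; linarith only [h])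
    linarith only [this]
  -- extremal data
  obtain ⟨u₃, hu₃, hMA⟩ := exists_rayleigh_max A
  obtain ⟨z₃, hz₃, hMC⟩ := exists_rayleigh_max C
  obtain ⟨eA, heA, hweA, ha₁₂, ha₂₃, hXA'⟩ := rayleighMin_package (B := B) hA hw hu₃ hminA hMA
  obtain ⟨eC, heC, hzeC, hc₁₂, hc₂₃, hXC'⟩ := rayleighMin_package (A := C) (B := Bᵀ) hC hz hz₃ hminC hMC
  rw [Matrix.transpose_transpose] at hXC'
  have hαm : m ≤ w ⬝ᵥ (A *ᵥ w) + eA ⬝ᵥ (A *ᵥ eA) := h12A w eA hw heA hweA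
  have hγm : m ≤ z ⬝ᵥ (C *ᵥ z) + eC ⬝ᵥ (C *ᵥ eC) := h12C z eC hz heC hzeC
  have hup := singular_upper (A := A) (C := C) hu hv hw hz hmaxB hYpos
  set bw := ((Bᵀ *ᵥ w) ⬝ᵥ (Bᵀ *ᵥ w)).sqrt with hbwdef
  set bz := ((B *ᵥ z) ⬝ᵥ (B *ᵥ z)).sqrt with hbzdef
  have hbw0 : 0 ≤ bw := Real.sqrt_nonneg _
  have hbz0 : 0 ≤ bz := Real.sqrt_nonneg _
  have hbw2 : bw ^ 2 = (Bᵀ *ᵥ w) ⬝ᵥ (Bᵀ *ᵥ w) :=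
    Real.sq_sqrt (Finset.sum_nonneg fun i _ ↦ mul_self_nonneg _)
  have hbz2 : bz ^ 2 = (B *ᵥ z) ⬝ᵥ (B *ᵥ z) :=
    Real.sq_sqrt (Finset.sum_nonneg fun i _ ↦ mul_self_nonneg _)
  have hbwY : bw ≤ Y := sqrt_normSq_le hYpos.le fun v' hv' ↦ hmaxB w v' hw hv'
  have hbzY : bz ≤ Y := by
    have h := sqrt_normSq_le (N := Bᵀ) (u := z) (L := Y) hYpos.le fun v' hv' ↦ by
      rw [Matrix.dotProduct_transpose_mulVec]; exact hmaxB v' z hv' hz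
    rwa [Matrix.transpose_transpose] at h
  have huA : u ⬝ᵥ (A *ᵥ u) ≤ u₃ ⬝ᵥ (A *ᵥ u₃) := hMA u hu
  have hvC : v ⬝ᵥ (C *ᵥ v) ≤ z₃ ⬝ᵥ (C *ᵥ z₃) := hMC v hv
  -- pinching bounds
  have ha₃A : u₃ ⬝ᵥ (A *ᵥ u₃) ≤ Ω * (w ⬝ᵥ (A *ᵥ w) + ρ) := (hPB.2 u₃ v w hu₃ hv hw).1.1
  have ha₃C : u₃ ⬝ᵥ (A *ᵥ u₃) ≤ Ω * (z ⬝ᵥ (C *ᵥ z) + ρ) := (hPB.2 u₃ v z hu₃ hv hz).2.1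
  have hc₃A : z₃ ⬝ᵥ (C *ᵥ z₃) ≤ Ω * (w ⬝ᵥ (A *ᵥ w) + ρ) := (hPB.2 z₃ v w hz₃ hv hw).1.2.2
  have hc₃C : z₃ ⬝ᵥ (C *ᵥ z₃) ≤ Ω * (z ⬝ᵥ (C *ᵥ z) + ρ) := (hPB.2 z₃ v z hz₃ hv hz).2.2.2
  have hYA : Y ≤ Ω * (w ⬝ᵥ (A *ᵥ w) + ρ) := (hPB.2 u v w hu hv hw).1.2.1
  have hYC : Y ≤ Ω * (z ⬝ᵥ (C *ᵥ z) + ρ) := (hPB.2 u v z hu hv hz).2.2.1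
  -- Thm. 2.1's bound at the pairs `(w, eA)`, `(z, eC)`
  have hα : 0 < w ⬝ᵥ (A *ᵥ w) + eA ⬝ᵥ (A *ᵥ eA) := hm.trans_le hαm
  have hγ : 0 < z ⬝ᵥ (C *ᵥ z) + eC ⬝ᵥ (C *ᵥ eC) := hm.trans_le hγm
  set x := sqrt ((w ⬝ᵥ (A *ᵥ w) + eA ⬝ᵥ (A *ᵥ eA)) * (z ⬝ᵥ (C *ᵥ z) + eC ⬝ᵥ (C *ᵥ eC))) with hxdef
  have hx : 0 < x := Real.sqrt_pos.2 (mul_pos hα hγ)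
  have hx2 : x ^ 2 = (w ⬝ᵥ (A *ᵥ w) + eA ⬝ᵥ (A *ᵥ eA)) * (z ⬝ᵥ (C *ᵥ z) + eC ⬝ᵥ (C *ᵥ eC)) :=
    Real.sq_sqrt (mul_pos hα hγ).le
  have h21 : 2 * Y ≤ (1 + K / max (log x) 2) * x := hIP u v w eA z eC hu hv hw heA hweA hz heC hzeC
  -- `ln υ ≤ C₁ - 1 + max{ln x, 2}`
  have hC₁ : (1 : ℝ) ≤ 1 + ρ / m := by
    have : (0 : ℝ) ≤ ρ / m := by positivity
    linarith only [this]
  have hυx : υ ≤ (1 + ρ / m) * x := upsilon_le_x hm hρ ha₁₂ hc₁₂ hαm hγm hXC hυ2 hx2 hx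
  have hℓnx : ℓn ≤ (1 + ρ / m) - 1 + max (log x) 2 := by
    have h1 : ℓn ≤ log ((1 + ρ / m) * x) := Real.log_le_log hυ hυx
    rw [Real.log_mul (by positivity) hx.ne'] at h1
    have h2 : log (1 + ρ / m) ≤ (1 + ρ / m) - 1 := Real.log_le_sub_one_of_pos (by positivity)
    have h3 : log x ≤ max (log x) 2 := le_max_left _ _
    linarith only [h1, h2, h3]
  -- the case analysis
  by_cases hcase : (w ⬝ᵥ (A *ᵥ w) + eA ⬝ᵥ (A *ᵥ eA)) * υ ≤
      2 * (υ + (Y - υ) / (2 + max K 0)) * (w ⬝ᵥ (A *ᵥ w) + ρ) ∧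
      (z ⬝ᵥ (C *ᵥ z) + eC ⬝ᵥ (C *ᵥ eC)) * υ ≤ 2 * (υ + (Y - υ) / (2 + max K 0)) * (z ⬝ᵥ (C *ᵥ z) + ρ)
  · exact (caseA_absurd hγ hXA hυ2 hυ hx2 hx h21 hℓn2 hκ hKs hμ hC₁ hℓnx hL1 hcase.1 hcase.2).elim
  have hB : 2 * (υ + (Y - υ) / (2 + max K 0)) * (w ⬝ᵥ (A *ᵥ w) + ρ) <
      (w ⬝ᵥ (A *ᵥ w) + eA ⬝ᵥ (A *ᵥ eA)) * υ ∨
      2 * (υ + (Y - υ) / (2 + max K 0)) * (z ⬝ᵥ (C *ᵥ z) + ρ) < (z ⬝ᵥ (C *ᵥ z) + eC ⬝ᵥ (C *ᵥ eC)) * υ := by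
    rcases not_and_or.1 hcase with h | h
    · exact Or.inl (not_le.1 h)
    · exact Or.inr (not_le.1 h)
  -- Lemma: `κ² ℓ ≤ K_s (1+κ)(ℓ - D)`
  set ℓ := (((w ⬝ᵥ (A *ᵥ w)) ^ 2 + bw ^ 2 + 2 * (eA ⬝ᵥ (A *ᵥ eA)) * (u₃ ⬝ᵥ (A *ᵥ u₃))) /
      (w ⬝ᵥ (A *ᵥ w) + ρ) + ((z ⬝ᵥ (C *ᵥ z)) ^ 2 + bz ^ 2 + 2 * (eC ⬝ᵥ (C *ᵥ eC)) * (z₃ ⬝ᵥ (C *ᵥ z₃))) /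
      (z ⬝ᵥ (C *ᵥ z) + ρ)) / 2 with hℓ
  set D := u₃ ⬝ᵥ (A *ᵥ u₃) + z₃ ⬝ᵥ (C *ᵥ z₃) + bw + bz with hD
  have hkey := lemma23 hm hρ hΩ ha₁₂ ha₂₃ hc₁₂ hc₂₃ hαm hγm hXA hXC hυ2 hυ hYpos hbw0 hbz0 hbwY hbzY
    ha₃A ha₃C hc₃A hc₃C hYA hYC hℓn2 hℓnυ hκ hKs hL0 hμ hL2 hL3 hB hℓ hD
  -- `D ≤ 4R`
  have hAnn : 0 ≤ ∑ k, ∑ l, |A k l| := Finset.sum_nonneg fun k _ ↦ Finset.sum_nonneg fun l _ ↦ abs_nonneg _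
  have hBnn : 0 ≤ ∑ k, ∑ l, |B k l| := Finset.sum_nonneg fun k _ ↦ Finset.sum_nonneg fun l _ ↦ abs_nonneg _
  have hCnn : 0 ≤ ∑ k, ∑ l, |C k l| := Finset.sum_nonneg fun k _ ↦ Finset.sum_nonneg fun l _ ↦ abs_nonneg _
  have hDR : D ≤ 4 * R := by
    have h1 : u₃ ⬝ᵥ (A *ᵥ u₃) ≤ R := by
      have := (abs_le.1 (abs_quad_le_sum A hu₃)).2; linarith only [this, hR, hBnn, hCnn]
    have h2 : z₃ ⬝ᵥ (C *ᵥ z₃) ≤ R := by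
      have := (abs_le.1 (abs_quad_le_sum C hz₃)).2; linarith only [this, hR, hAnn, hBnn]
    have h3 : Y ≤ R := by
      have := (abs_le.1 (abs_bilin_le_sum B hu hv)).2; linarith only [this, hR, hAnn, hCnn, hYdef]
    rw [hD]; linarith only [h1, h2, h3, hbwY, hbzY]
  -- the derivative, and the bookkeeping
  have hup' : u ⬝ᵥ ((A * B + B * C + (2 : ℝ) • B.sharp) *ᵥ v) ≤
      Y * (u ⬝ᵥ (A *ᵥ u) + v ⬝ᵥ (C *ᵥ v) + bw + bz) := hup
  have hYB : u ⬝ᵥ ((A * B + B * C + (2 : ℝ) • B.sharp) *ᵥ v) ≤ Y * D := by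
    have h1 : u ⬝ᵥ (A *ᵥ u) + v ⬝ᵥ (C *ᵥ v) + bw + bz ≤ D := by rw [hD]; linarith only [huA, hvC]
    exact hup'.trans (mul_le_mul_of_nonneg_left h1 hYpos.le)
  have hG'val : impQG' ρ L P s (A, B, C) (field (A, B, C)) ((u, v), (w, z)) =
      (1 + κ - κ / ℓn) * υ * ℓ + P * κ * υ - u ⬝ᵥ ((A * B + B * C + (2 : ℝ) • B.sharp) *ᵥ v) := by
    have e1 : impQG' ρ L P s (A, B, C) (field (A, B, C)) ((u, v), (w, z)) =
        impFnDeriv Ks 2 υ * (((w ⬝ᵥ ((A * A + B * Bᵀ + (2 : ℝ) • A.sharp) *ᵥ w)) * (z ⬝ᵥ (C *ᵥ z) + ρ) +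
          (w ⬝ᵥ (A *ᵥ w) + ρ) * (z ⬝ᵥ ((C * C + Bᵀ * B + (2 : ℝ) • C.sharp) *ᵥ z))) / (2 * υ)) +
          L * P * exp (P * s) * phiQ 2 υ - u ⬝ᵥ ((A * B + B * C + (2 : ℝ) • B.sharp) *ᵥ v) := by
      simp [impQG', impQX, field, hυdef, hKsdef]
    rw [e1, hfx', hφ, hXA', hXC', ← hbw2, ← hbz2]
    have hXA0 : w ⬝ᵥ (A *ᵥ w) + ρ ≠ 0 := hXA.ne'
    have hXC0 : z ⬝ᵥ (C *ᵥ z) + ρ ≠ 0 := hXC.ne'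
    have hυ0 : υ ≠ 0 := hυ.ne'
    have hℓn0' : ℓn ≠ 0 := hℓn0.ne'
    have hqx : ∀ N : ℝ, N / (2 * υ) = υ * N / (2 * ((w ⬝ᵥ (A *ᵥ w) + ρ) * (z ⬝ᵥ (C *ᵥ z) + ρ))) := by
      intro N
      rw [← hυ2]
      field_simp
    rw [hqx, hℓ, hκ, hKsdef]
    field_simp
  refine bookkeeping23 (P' := P) hkey hκ hℓn0 hKs0 hυ hP (G := impQG ρ L P s (A, B, C) ((u, v), (w, z)))
    (by rw [hGval, hfx]) hG0 hYB hDR hG'val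

/-! ### Thm. 2.3, ODE part -/

/-- **Hamilton 1997, Thm. 2.3, ODE part (proved)** — exactly the hypothesis `h23` of
`hamilton_chenZhu_pinching_of_ode₁` (`PinchingEstimatesReduction5.lean`), realised with `Q = 2`,
`L₀ = impQL₀ m ρ Ω K`, `P₀ = 0`: the family
`{b₃ ≤ (1 + Le^{Pt}/max{ln √((a₁+ρ)(c₁+ρ)), Q}) √((a₁+ρ)(c₁+ρ))}` is forward invariant under
Hamilton's ODE relative to the previous estimates. [cite: Hamilton1997, §2.2, Thm. 2.3 (pp. 17–20)] -/
theorem hamilton1997_B23_ode : ∀ m Λ Ξ ρ Ω K : ℝ, 0 < m → 0 < Λ → 0 < Ξ → 0 < ρ → 0 < Ω →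
    ∃ Q : ℝ, 2 ≤ Q ∧ ∃ L₀ P₀ : ℝ, ∀ L P : ℝ, L₀ ≤ L → P₀ ≤ P → 0 < L → 0 < P →
      IsInvariantRel field
        (fun t ↦ {p : Blocks | (p.1.IsSymm ∧ p.2.2.IsSymm) ∧ p.1.TwoSmallestEigenvaluesSumGE m ∧
          p.2.2.TwoSmallestEigenvaluesSumGE m ∧ SingularValuesSumSqLE p Λ ∧
          MaxLEPairSum p Ξ ∧ p.1.trace = p.2.2.trace ∧
          Matrix.PinchedBy p.1 p.2.1 p.2.2 ρ Ω ∧ ImprovedPinching p K ∧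
          SingularValueLEExp p (L / 2) P ρ t})
        (fun t ↦ {p | ImprovedPinchingQ p ρ L P Q t}) := by
  intro m Λ Ξ ρ Ω K hm _ _ hρ hΩ
  refine ⟨2, le_rfl, impQL₀ m ρ Ω K, 0, fun L P hL _ hL0 hP γ t₀ t₁ ht₀ h₁ hγ hKc hin ↦ ?_⟩
  have hγc := IsSolutionOn.continuousOn hγ
  have hpos : ∀ s ∈ Icc t₀ t₁, ∀ q ∈ unitSet4, 0 < impQX ρ (γ s) q := by
    intro s hs q hq
    obtain ⟨-, -, -, -, -, -, hPB, -⟩ := hKc s hs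
    exact mul_pos (hPB.1 _ hq.2.1).1 (hPB.1 _ hq.2.2).2
  have hGc := continuousOn_impQG_family ρ L P hγc hpos
  have hG'c := continuousOn_impQG'_family ρ L P hγc hpos
  have hGd : ∀ q ∈ unitSet4, ∀ s ∈ Icc t₀ t₁, _root_.HasDerivAt (fun t ↦ impQG ρ L P t (γ t) q)
      (impQG' ρ L P s (γ s) (field (γ s)) q) s := fun q hq s hs ↦
    hasDerivAt_impQG ρ L P (hγ s hs) q (hpos s hs q hq)
  -- uniform bound `R`
  have hent : ∀ {f : Blocks → Matrix (Fin 3) (Fin 3) ℝ}, Continuous f →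
      ContinuousOn (fun t ↦ ∑ k, ∑ l, |f (γ t) k l|) (Icc t₀ t₁) := by
    intro f hf
    have h : ContinuousOn (fun t ↦ f (γ t)) (Icc t₀ t₁) := hf.comp_continuousOn hγc
    exact continuousOn_finsetSum _ fun k _ ↦ continuousOn_finsetSum _ fun l _ ↦
      ((continuousOn_pi.1 (continuousOn_pi.1 h k) l)).abs
  have hScont : ContinuousOn (fun t ↦ (∑ k, ∑ l, |(γ t).1 k l|) + (∑ k, ∑ l, |(γ t).2.1 k l|) +
      ∑ k, ∑ l, |(γ t).2.2 k l|) (Icc t₀ t₁) :=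
    ((hent (f := fun p ↦ p.1) continuous_fst).add
      (hent (f := fun p ↦ p.2.1) (continuous_fst.comp continuous_snd))).add
      (hent (f := fun p ↦ p.2.2) (continuous_snd.comp continuous_snd))
  obtain ⟨sR, -, hR⟩ := isCompact_Icc.exists_isMaxOn (nonempty_Icc.2 h₁) hScont
  set R := (∑ k, ∑ l, |(γ sR).1 k l|) + (∑ k, ∑ l, |(γ sR).2.1 k l|) + ∑ k, ∑ l, |(γ sR).2.2 k l|
    with hRdef
  have hR' : ∀ s ∈ Icc t₀ t₁, (∑ k, ∑ l, |(γ s).1 k l|) + (∑ k, ∑ l, |(γ s).2.1 k l|) +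
      ∑ k, ∑ l, |(γ s).2.2 k l| ≤ R := fun s hs ↦ hR hs
  have hC0 : 0 ≤ 4 * R := by positivity
  have key := minOverSet_nonneg_of_deriv (G := fun t q ↦ impQG ρ L P t (γ t) q)
    (G' := fun t q ↦ impQG' ρ L P t (γ t) (field (γ t)) q) isCompact_unitSet4 unitSet4_nonempty
    hGc hGd hG'c h₁ one_pos hC0 (η := 1) (fun s hs q hq hqmin _ hG0 ↦ ?_) ?_
  · -- at `t₁`
    obtain ⟨-, -, -, -, -, -, -, -, hSV⟩ := hKc t₁ (right_mem_Icc.2 h₁)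
    have hall := (le_minOverSet_iff isCompact_unitSet4 unitSet4_nonempty (continuousOn_slice
      (G := fun t q ↦ impQG ρ L P t (γ t) q) hGc (right_mem_Icc.2 h₁)) 0).1 key
    refine improvedPinchingQ_of_impQG_nonneg (hpos t₁ (right_mem_Icc.2 h₁)) (fun q hq ↦ ?_) hall
    have h1 : q.1.1 ⬝ᵥ ((γ t₁).2.1 *ᵥ q.1.2) ≤ L / 2 * exp (P * t₁) * sqrt (impQX ρ (γ t₁) q) :=
      hSV _ _ _ _ hq.1.1 hq.1.2 hq.2.1 hq.2.2
    have hs0 : 0 ≤ sqrt (impQX ρ (γ t₁) q) := Real.sqrt_nonneg _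
    nlinarith only [h1, hs0]
  · have hsI : s ∈ Icc t₀ t₁ := Ico_subset_Icc_self hs
    obtain ⟨⟨hA, hC⟩, h12A, h12C, -, -, -, hPB, hIP, hSV⟩ := hKc s hsI
    exact improvingQ_sign hm hρ hΩ hL hL0 hP.le (ht₀.trans hs.1) hA hC h12A h12C hPB hIP hSV
      (hR' s hsI) hq hqmin hG0
  · refine (le_minOverSet_iff isCompact_unitSet4 unitSet4_nonempty (continuousOn_slice
      (G := fun t q ↦ impQG ρ L P t (γ t) q) hGc (left_mem_Icc.2 h₁)) 0).2 fun q hq ↦ ?_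
    exact impQG_nonneg_of_improvedPinchingQ hL0.le (hpos t₀ (left_mem_Icc.2 h₁)) hin hq

end HamiltonODE

end Literature.Geometry.Riemannian

end
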